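import Summits.AtomisticToContinuum.HydrodynamicLimit.Theorems.BoltzmannGreenKubo.Negative.MazurFloor
import Literature.Analysis.FluidPDE.HardSphereAlexander
import Literature.Analysis.UnboundedOperators.LinearizedBoltzmannProofs

/-!
# `BoltzmannGreenKubo` with orthogonality to the MOMENTUM dropped is FALSE (file 7/7: the negative lemma)

Negative knowledge for the crux `AntiMazurCoboundaries.BoltzmannGreenKubo` (stmt-AtomisticToContinuum-13985):
`BoltzmannGreenKuboWithoutOrthMomentum` is the crux VERBATIM with its clause `g ⊥ span(1, v, |v|²)` weakened to
`g ⊥ span(1, |v|²)`, and it is FALSE — witness `φ ≡ 1`, `g = g_M` (file 5), Alexander's flow, and the mechanised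
Mazur floor (file 6): the kinetic-window functional per particle is `≥ m² ≥ 1/4` for every `N`, `σ`, window, so
`s·V ≤ 2D + 1` (`D = dirichletFormInv L g_M ≥ 0`) fails at `s = max(s₀, 8D + 8)`. Hence ORTHOGONALITY TO THE
MOMENTUM IS LOAD-BEARING ON ITS OWN. From `Cruxes/BoltzmannGreenKubo/Disproof.lean` §1h.
refuter-cdisprove-stmt-AtomisticToContinuum-13985-0.
-/

noncomputable section

namespace Summit.AtomisticToContinuum.HydrodynamicLimit.Theorems

open MeasureTheory ProbabilityTheory Filter Topology Set
open Literature.Analysis.FluidPDE Literature.MathematicalPhysics.KineticTheory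
open Literature.Analysis.UnboundedOperators
open scoped InnerProductSpace
open BoltzmannGreenKuboOrthMomentum

/-- `BoltzmannGreenKubo` with the orthogonality clause WEAKENED to `g ⊥ span(1, |v|²)` only (orthogonality to the
momentum components `v ↦ ⟪b, v⟫` dropped; everything else verbatim). -/
def BoltzmannGreenKuboWithoutOrthMomentum : Prop :=
  ∀ (a θ : ℝ) (u₀ : Literature.MathematicalPhysics.KineticTheory.V3), 0 < a → 0 < θ → ∀ (φ : Literature.MathematicalPhysics.KineticTheory.T3 → ℝ) (g : Literature.MathematicalPhysics.KineticTheory.V3 → ℝ), Continuous φ → Continuous g → (∀ x, |φ x| ≤ 1) → (∃ K : ℝ, ∀ v, |g v| ≤ K) → (∀ (c₀ c₂ : ℝ), ∫ v, g v * (c₀ + c₂ * ‖v‖ ^ 2) ∂(ProbabilityTheory.stdGaussian Literature.MathematicalPhysics.KineticTheory.V3) = 0) → ∀ η : ℝ, 0 < η → ∃ s₀ : ℝ, 0 < s₀ ∧ ∀ s : ℝ, s₀ ≤ s → ∃ σ₀ : ℝ, 0 < σ₀ ∧ ∀ σ : ℝ, 0 < σ → σ < σ₀ → (∀ (N : ℕ)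 (Φ : Literature.Analysis.FluidPDE.HardSphereFlow (Literature.Analysis.FluidPDE.Torus.geometry (Fin 3)) (Literature.MathematicalPhysics.KineticTheory.hsDiameter σ N) (N + 1)), MeasureTheory.IsProbabilityMeasure (Literature.MathematicalPhysics.KineticTheory.localGibbsLaw σ (fun _ => a) (fun _ => u₀) (fun _ => θ) N Φ)) ∧ ∃ N₀ : ℕ, ∀ N : ℕ, N₀ ≤ N → ∀ Φ : Literature.Analysis.FluidPDE.HardSphereFlow (Literature.Analysis.FluidPDE.Torus.geometry (Fin 3)) (Literature.MathematicalPhysics.KineticTheory.hsDiameter σ N) (N + 1), (let h : ℝ := s / (σ ^ 2 * Real.sqrt θ) * ((N + 1 : ℕ) : ℝ) ^ (-(1 / 3 : ℝ)); |s * ((∫⁻ z, ENNReal.ofReal ((h⁻¹ * ∫ r in (0 : ℝ)..h, ∑ i, φ (Φ.flow r z i).1 * g ((Real.sqrt θ)⁻¹ • ((Φ.flow r z i).2 - u₀))) ^ 2) ∂(Literature.MathematicalPhysics.KineticTheory.localGibbsLaw σ (fun _ => a) (fun _ => u₀) (fun _ => θ) N Φ)).toReal / (((N : ℝ)) + 1))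 - 2 * (∫ x, φ x ^ 2) * Literature.Analysis.UnboundedOperators.dirichletFormInv (Literature.Analysis.UnboundedOperators.hardSphereLinearizedOp (E := Literature.MathematicalPhysics.KineticTheory.V3)) g| ≤ η)

/-- **ANY PROOF MUST USE ORTHOGONALITY TO THE MOMENTUM** (the clause `g ⊥ v` is load-bearing on its own): with it
dropped the statement is FALSE. Witness `φ ≡ 1`, `g = g_M` (odd, so `⊥ 1, |v|²`, but `E γ[g_M w₀] = m ≥ 1/2`): by
the mechanised MAZUR FLOOR (`mazur_floor`: stationarity of `G_N` + momentum conservation + joint measurability of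
the flow + Fubini + Cauchy–Schwarz) the kinetic-window functional per particle is `≥ m² ≥ 1/4` for EVERY `N`, `σ`,
window, so `s · (≥ 1/4) ≤ 2D + 1` fails at `s = max(s₀, 8D + 8)` (`D = dirichletFormInv L g_M ≥ 0`, a junk-or-not
real number). This is Mazur's inequality for deterministic hard spheres, kernel-checked. [folklore] -/
theorem boltzmannGreenKubo_false_without_orthMomentum : ¬ BoltzmannGreenKuboWithoutOrthMomentum := by
  intro hyp
  set D := dirichletFormInv (hardSphereLinearizedOp (E := V3)) gM with hDdef
  have hD0 : 0 ≤ D := dirichletFormInv_nonneg _ _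
  obtain ⟨s₀, hs₀, h2⟩ := hyp 1 1 0 one_pos one_pos (fun _ => 1) gM continuous_const continuous_gM
    (fun _ => by simp) ⟨5, abs_gM_le⟩ gM_orth 1 one_pos
  set s : ℝ := max s₀ (8 * D + 8) with hsdef
  have hs0 : s₀ ≤ s := le_max_left _ _
  have hs8 : 8 * D + 8 ≤ s := le_max_right _ _
  have hspos : 0 < s := by linarith
  obtain ⟨σ₀, hσ₀, h3⟩ := h2 s hs0
  set σ : ℝ := min (σ₀ / 2) (1 / 4) with hσdef
  have hσpos : 0 < σ := lt_min (by linarith) (by norm_num)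
  have hσlt : σ < σ₀ := lt_of_le_of_lt (min_le_left _ _) (by linarith)
  have hσle : σ ≤ 1 / 4 := min_le_right _ _
  have hσhalf : σ ≤ 1 / 2 := by linarith
  obtain ⟨hprob, N₀, h4⟩ := h3 σ hσpos hσlt
  have hεpos : 0 < hsDiameter σ N₀ := hsDiameter_pos hσpos N₀
  have hεlt : hsDiameter σ N₀ < 2⁻¹ := by
    have := hsDiameter_le hσpos.le N₀
    linarith
  obtain ⟨Φ⟩ := HardSphereFlow.nonempty_torus_holds (d := Fin 3) hεpos hεlt (N₀ + 1)
  haveI := hprob N₀ Φ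
  have k := h4 N₀ le_rfl Φ
  have hh : 0 < s / (σ ^ 2 * Real.sqrt 1) * ((N₀ + 1 : ℕ) : ℝ) ^ (-(1 / 3 : ℝ)) := by positivity
  dsimp only at k
  set hN : ℝ := s / (σ ^ 2 * Real.sqrt 1) * ((N₀ + 1 : ℕ) : ℝ) ^ (-(1 / 3 : ℝ)) with hhN
  simp only [one_mul, Real.sqrt_one, inv_one, one_smul, sub_zero] at k
  have hint1 : ∫ x : T3, (1 : ℝ) ^ 2 = 1 := by simp
  rw [hint1, mul_one] at k
  -- the floor
  have hfloor : ((N₀ : ℝ) + 1) * mM ^ 2 ≤ ∫ z, (hN⁻¹ * ∫ r in (0 : ℝ)..hN, ∑ i, gM ((Φ.flow r z i).2)) ^ 2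
      ∂(localGibbsLaw σ (fun _ => 1) (fun _ => 0) (fun _ => 1) N₀ Φ) :=
    mazur_floor (N := N₀) hσhalf Φ hh
  have hAm : AEStronglyMeasurable (fun z => (hN⁻¹ * ∫ r in (0 : ℝ)..hN, ∑ i, gM ((Φ.flow r z i).2)) ^ 2)
      (localGibbsLaw σ (fun _ => 1) (fun _ => 0) (fun _ => 1) N₀ Φ) :=
    ((integrable_window 1 1 0 Φ measurable_Fobs (integrable_Fobs Φ) hh.le).aestronglyMeasurable.const_mul _).pow 2
  have hW : (∫⁻ z, ENNReal.ofReal ((hN⁻¹ * ∫ r in (0 : ℝ)..hN, ∑ i, gM ((Φ.flow r z i).2)) ^ 2)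
      ∂(localGibbsLaw σ (fun _ => 1) (fun _ => 0) (fun _ => 1) N₀ Φ)).toReal =
      ∫ z, (hN⁻¹ * ∫ r in (0 : ℝ)..hN, ∑ i, gM ((Φ.flow r z i).2)) ^ 2
        ∂(localGibbsLaw σ (fun _ => 1) (fun _ => 0) (fun _ => 1) N₀ Φ) := by
    rw [integral_eq_lintegral_of_nonneg_ae (Eventually.of_forall fun z => sq_nonneg _) hAm]
  rw [hW] at k
  have hm := half_le_mM
  have hWge : mM ^ 2 ≤ (∫ z, (hN⁻¹ * ∫ r in (0 : ℝ)..hN, ∑ i, gM ((Φ.flow r z i).2)) ^ 2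
      ∂(localGibbsLaw σ (fun _ => 1) (fun _ => 0) (fun _ => 1) N₀ Φ)) / ((N₀ : ℝ) + 1) := by
    rw [le_div_iff₀ (by positivity)]
    linarith [hfloor]
  rw [← hDdef, abs_le] at k
  have hq : (1 / 4 : ℝ) ≤ mM ^ 2 := by nlinarith [hm]
  have hmul : s * (1 / 4) ≤ s * ((∫ z, (hN⁻¹ * ∫ r in (0 : ℝ)..hN, ∑ i, gM ((Φ.flow r z i).2)) ^ 2
      ∂(localGibbsLaw σ (fun _ => 1) (fun _ => 0) (fun _ => 1) N₀ Φ)) / ((N₀ : ℝ) + 1)) :=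
    mul_le_mul_of_nonneg_left (hq.trans hWge) hspos.le
  linarith [k.2, hmul, hs8, hD0]





end Summit.AtomisticToContinuum.HydrodynamicLimit.Theorems

end
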